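import Mathlib.Algebra.BigOperators.Intervals
import Mathlib.Algebra.Order.BigOperators.Group.Finset
import Mathlib.Tactic

/-! # RankLevelSetSkewConv — THE CUMULATIVE SKEW PARAMETER IS ADDITIVE UNDER CONVOLUTION (night-1 g30; dossier §42)

For a sequence `v : ℕ → ℕ` and `R : ℕ` write `Skew v R` for the CUMULATIVE SKEW «`v i ≤ v j` whenever `i < j` and
`i + j ≤ R`» («`v` is skewed right about `R/2`»: every level set `{v ≥ t}` that starts at `i ≤ R/2` contains `[i, R − i]`).
This is the shape of the cell's contain-set statements: the cumulative (CX*) of a contain profile is `Skew α^X (#E − 1)`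
(`MinorPairSkew M X ∅ (#E − 2#X − 1)` in the shifted index), the monotone form of the bi-independent profile is
`Skew D #E`, the «half rule» is `Skew α^X #E`. THE THEOREM (`skew_conv`): **`Skew a R₁ → Skew b R₂ → Skew (a ⋆ b) (R₁ + R₂)`**
for the convolution `(a ⋆ b) k = Σ_{s ≤ k} a s · b (k − s)` — the skew parameters ADD. Consequences (next module): the
cumulative skew of the mixed profile of a pair of complementary minors is additive under direct sums with ANY split
signature; a (CX*)-matroid ⊕ a half-rule matroid (uniform, or `X = ∅` with Mono) satisfies (CX*) with the split
contain-set; two (CX*)-matroids give `Skew (#E − 2)` — the split sum loses at most half a step.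

PROOF. (1) `skew_shift`: shifting `a` by `t` adds `2t` to the parameter. (2) THE KEY LEMMA `skew_window`: the window sum
`W_L a k = Σ_{s ≤ L} a (k − s)` of a `Skew a R` sequence is `Skew (R + L)`. For `i < j`, `i + j ≤ R + L`, `d = j − i`:
if `L < d`, reflect the `j`-window (`s ↦ L − s`) and compare termwise — the pairs `(i − s, j − L + s)` have sum
`i + j − L ≤ R` and `i − s < j − L + s`; if `d ≤ L`, the two windows overlap in `[j − L, i]` (the same mass, by
`s ↦ s + d`), and the `d` dropped terms `s ∈ (L − d, L]` of the `i`-window pair with the `d` new terms `L − s` of the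
`j`-window exactly as before. (3) A `Skew b R₂` sequence is a nonnegative combination of indicators of symmetric
windows `[m, R₂ − m]` (`2m ≤ R₂`) and of points `t` with `2t > R₂`: peel the minimum level `b m` of the lowest
support point `m` as `b m · 1_{[m, R₂ − m]}` (the remainder is again `Skew R₂`, with smaller mass); convolution is
linear in `b`, `a ⋆ 1_{[m, R₂−m]}` is the window sum of length `R₂ − 2m` shifted by `m` (parameter
`R + R₂ − 2m + 2m`), and `a ⋆ 1_{t}` is the shift by `t` (parameter `R + 2t > R + R₂`). Strong induction on the mass
of `b` below `R₁ + R₂` (only those values enter). Every declaration has a docstring; imports: Mathlib only.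
Axioms: standard. -/

namespace PercRepro

namespace SkewConv

open Finset

/-! ## Definitions -/

/-- **The cumulative skew**: `v i ≤ v j` whenever `i < j` and `i + j ≤ R` («skewed right about `R/2`»). -/
def Skew (v : ℕ → ℕ) (R : ℕ) : Prop := ∀ i j : ℕ, i < j → i + j ≤ R → v i ≤ v j

/-- The convolution `(a ⋆ b) k = Σ_{s ≤ k} a s · b (k − s)`. -/
def conv (a b : ℕ → ℕ) (k : ℕ) : ℕ := ∑ s ∈ range (k + 1), a s * b (k - s)

/-- The shift by `t`: `(shiftSeq a t) k = a (k − t)` for `k ≥ t`, `0` below. -/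
def shiftSeq (a : ℕ → ℕ) (t : ℕ) (k : ℕ) : ℕ := if t ≤ k then a (k - t) else 0

/-- The window sum of length `L + 1`: `(windowSeq a L) k = Σ_{s ≤ L, s ≤ k} a (k − s)`. -/
def windowSeq (a : ℕ → ℕ) (L : ℕ) (k : ℕ) : ℕ := ∑ s ∈ range (L + 1), shiftSeq a s k

/-- The indicator of the interval `[m, u]`. -/
def indSeq (m u : ℕ) (t : ℕ) : ℕ := if m ≤ t ∧ t ≤ u then 1 else 0

/-! ## Closure properties of the skew -/

/-- The skew is monotone in the parameter. -/
lemma skew_mono {v : ℕ → ℕ} {R R' : ℕ} (h : Skew v R) (hR : R' ≤ R) : Skew v R' :=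
  fun i j hij hR' => h i j hij (hR'.trans hR)

/-- The skew only depends on the values at indices `≤ R`. -/
lemma skew_congr {v w : ℕ → ℕ} {R : ℕ} (h : Skew v R) (hvw : ∀ k, k ≤ R → v k = w k) : Skew w R := by
  intro i j hij hR
  rw [← hvw i (by omega), ← hvw j (by omega)]
  exact h i j hij hR

/-- The zero sequence is skew. -/
lemma skew_zero (R : ℕ) : Skew (fun _ => 0) R := fun _ _ _ _ => le_rfl

/-- Sums of skew sequences are skew. -/
lemma skew_add {v w : ℕ → ℕ} {R : ℕ} (hv : Skew v R) (hw : Skew w R) : Skew (fun k => v k + w k) R :=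
  fun i j hij hR => Nat.add_le_add (hv i j hij hR) (hw i j hij hR)

/-- Nonnegative multiples of skew sequences are skew. -/
lemma skew_smul {v : ℕ → ℕ} {R : ℕ} (hv : Skew v R) (c : ℕ) : Skew (fun k => c * v k) R :=
  fun i j hij hR => Nat.mul_le_mul_left c (hv i j hij hR)

/-- Finite sums of skew sequences are skew. -/
lemma skew_sum {ι : Type*} (s : Finset ι) (f : ι → ℕ → ℕ) {R : ℕ} (h : ∀ x ∈ s, Skew (f x) R) :
    Skew (fun k => ∑ x ∈ s, f x k) R := by
  classical
  induction s using Finset.induction_on with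
  | empty => simpa using skew_zero R
  | insert x s hx ih =>
    have h1 : Skew (f x) R := h x (Finset.mem_insert_self x s)
    have h2 : Skew (fun k => ∑ y ∈ s, f y k) R := ih (fun y hy => h y (Finset.mem_insert_of_mem hy))
    have := skew_add h1 h2
    refine skew_congr this (fun k _ => ?_)
    rw [Finset.sum_insert hx]

/-- **Shifting adds twice the shift to the parameter**: `Skew a R → Skew (shiftSeq a t) (R + 2t)`. -/
lemma skew_shift {a : ℕ → ℕ} {R : ℕ} (ha : Skew a R) (t : ℕ) : Skew (shiftSeq a t) (R + 2 * t) := by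
  intro i j hij hR
  unfold shiftSeq
  by_cases hti : t ≤ i
  · have htj : t ≤ j := by omega
    rw [if_pos hti, if_pos htj]
    exact ha (i - t) (j - t) (by omega) (by omega)
  · rw [if_neg hti]
    exact Nat.zero_le _

/-! ## The key lemma: window sums -/

/-- A shifted term by `s > k` vanishes. -/
lemma shiftSeq_eq_zero_of_lt {a : ℕ → ℕ} {s k : ℕ} (h : k < s) : shiftSeq a s k = 0 := by
  unfold shiftSeq
  rw [if_neg (by omega)]

/-- **THE WINDOW LEMMA**: `Skew a R → Skew (windowSeq a L) (R + L)`. -/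
theorem skew_window {a : ℕ → ℕ} {R : ℕ} (ha : Skew a R) (L : ℕ) : Skew (windowSeq a L) (R + L) := by
  intro i j hij hR
  unfold windowSeq
  -- the `j`-window, reflected
  have hrefl : ∑ s ∈ range (L + 1), shiftSeq a s j = ∑ s ∈ range (L + 1), shiftSeq a (L - s) j := by
    rw [← Finset.sum_range_reflect (fun s => shiftSeq a s j) (L + 1)]
    refine Finset.sum_congr rfl fun s hs => ?_
    rw [Finset.mem_range] at hs
    have : L + 1 - 1 - s = L - s := by omega
    rw [this]
  by_cases hLd : L < j - i
  · -- disjoint windows: termwise after the reflection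
    rw [hrefl]
    refine Finset.sum_le_sum fun s hs => ?_
    rw [Finset.mem_range] at hs
    unfold shiftSeq
    by_cases hsi : s ≤ i
    · rw [if_pos hsi, if_pos (by omega)]
      exact ha (i - s) (j - (L - s)) (by omega) (by omega)
    · rw [if_neg hsi]
      exact Nat.zero_le _
  · -- overlapping windows: the common part cancels, the `d` dropped terms pair with the `d` new terms
    push Not at hLd
    set d := j - i with hd
    have hd1 : 1 ≤ d := by omega
    have hdL : d ≤ L := hLd
    -- the common part: `Σ_{s ≤ L − d} W_i(s) = Σ_{s ∈ [d, L]} W_j(s)`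
    have hcommon : ∑ s ∈ range (L - d + 1), shiftSeq a s i = ∑ s ∈ Ico d (L + 1), shiftSeq a s j := by
      rw [Finset.sum_Ico_eq_sum_range]
      have : L + 1 - d = L - d + 1 := by omega
      rw [this]
      refine Finset.sum_congr rfl fun s _ => ?_
      unfold shiftSeq
      by_cases hsi : s ≤ i
      · rw [if_pos hsi, if_pos (by omega)]
        congr 1
        omega
      · rw [if_neg hsi, if_neg (by omega)]
    -- the `i`-window splits at `L − d`, the `j`-window at `d`
    have hsplit_i : ∑ s ∈ range (L + 1), shiftSeq a s i =
        ∑ s ∈ range (L - d + 1), shiftSeq a s i + ∑ s ∈ Ico (L - d + 1) (L + 1), shiftSeq a s i :=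
      (Finset.sum_range_add_sum_Ico _ (by omega)).symm
    have hsplit_j : ∑ s ∈ range (L + 1), shiftSeq a s j =
        ∑ s ∈ range d, shiftSeq a s j + ∑ s ∈ Ico d (L + 1), shiftSeq a s j :=
      (Finset.sum_range_add_sum_Ico _ (by omega)).symm
    -- the dropped terms, reflected onto `range d`
    have hdrop : ∑ s ∈ Ico (L - d + 1) (L + 1), shiftSeq a s i = ∑ s ∈ range d, shiftSeq a (L - s) i := by
      rw [Finset.sum_Ico_eq_sum_range]
      have : L + 1 - (L - d + 1) = d := by omega
      rw [this, ← Finset.sum_range_reflect (fun s => shiftSeq a (L - s) i) d]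
      refine Finset.sum_congr rfl fun s hs => ?_
      rw [Finset.mem_range] at hs
      have : L - (d - 1 - s) = L - d + 1 + s := by omega
      rw [this]
    -- each dropped term is at most the corresponding new term
    have hpair : ∑ s ∈ range d, shiftSeq a (L - s) i ≤ ∑ s ∈ range d, shiftSeq a s j := by
      refine Finset.sum_le_sum fun s hs => ?_
      rw [Finset.mem_range] at hs
      unfold shiftSeq
      by_cases hsi : L - s ≤ i
      · rw [if_pos hsi, if_pos (by omega)]
        exact ha (i - (L - s)) (j - s) (by omega) (by omega)
      · rw [if_neg hsi]
        exact Nat.zero_le _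
    rw [hsplit_i, hsplit_j, hcommon, hdrop]
    omega

/-! ## Convolution with an interval indicator is a shifted window -/

/-- `a ⋆ 1_{[m, u]}` is the window sum of length `u − m + 1` shifted by `m`. -/
lemma conv_indSeq_eq {a : ℕ → ℕ} {m u : ℕ} (hmu : m ≤ u) (k : ℕ) :
    conv a (indSeq m u) k = shiftSeq (windowSeq a (u - m)) m k := by
  unfold conv shiftSeq windowSeq
  by_cases hmk : m ≤ k
  · rw [if_pos hmk]
    -- left: Σ_{s ≤ k, m ≤ k − s ≤ u} a s; right: Σ_{s' ≤ u − m, s' ≤ k − m} a (k − m − s')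
    have hl : ∑ s ∈ range (k + 1), a s * indSeq m u (k - s) =
        ∑ s ∈ (range (k + 1)).filter (fun s => m ≤ k - s ∧ k - s ≤ u), a s := by
      rw [Finset.sum_filter]
      refine Finset.sum_congr rfl fun s _ => ?_
      unfold indSeq
      split_ifs <;> simp
    have hr : ∑ s ∈ range (u - m + 1), shiftSeq a s (k - m) =
        ∑ s ∈ (range (u - m + 1)).filter (fun s => s ≤ k - m), a (k - m - s) := by
      rw [Finset.sum_filter]
      refine Finset.sum_congr rfl fun s _ => ?_
      unfold shiftSeq
      split_ifs <;> rfl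
    rw [hl, hr]
    refine Finset.sum_nbij' (fun s => k - m - s) (fun s => k - m - s) ?_ ?_ ?_ ?_ ?_
    · intro s hs
      simp only [Finset.mem_filter, Finset.mem_range] at hs ⊢
      omega
    · intro s hs
      simp only [Finset.mem_filter, Finset.mem_range] at hs ⊢
      omega
    · intro s hs
      simp only [Finset.mem_filter, Finset.mem_range] at hs
      omega
    · intro s hs
      simp only [Finset.mem_filter, Finset.mem_range] at hs
      omega
    · intro s hs
      simp only [Finset.mem_filter, Finset.mem_range] at hs
      congr 1
      omega
  · rw [if_neg hmk]
    refine Finset.sum_eq_zero fun s hs => ?_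
    unfold indSeq
    rw [if_neg (by omega), mul_zero]

/-- **`a ⋆ 1_{[m, R₂ − m]}` has parameter `R₁ + R₂`** when `2m ≤ R₂`. -/
lemma skew_conv_indSeq {a : ℕ → ℕ} {R₁ R₂ m : ℕ} (ha : Skew a R₁) (hm : 2 * m ≤ R₂) :
    Skew (conv a (indSeq m (R₂ - m))) (R₁ + R₂) := by
  have h1 := skew_shift (skew_window ha (R₂ - m - m)) m
  have h2 : R₁ + (R₂ - m - m) + 2 * m = R₁ + R₂ := by omega
  rw [h2] at h1
  exact skew_congr h1 fun k _ => (conv_indSeq_eq (by omega) k).symm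

/-! ## Linearity of the convolution in the second argument -/

/-- `a ⋆ (c·x + y) = c·(a ⋆ x) + a ⋆ y` pointwise. -/
lemma conv_add_smul (a x y : ℕ → ℕ) (c : ℕ) (k : ℕ) :
    conv a (fun t => c * x t + y t) k = c * conv a x k + conv a y k := by
  unfold conv
  rw [Finset.mul_sum, ← Finset.sum_add_distrib]
  refine Finset.sum_congr rfl fun s _ => ?_
  ring

/-- `(a ⋆ b) k = Σ_{t ≤ T} b t · (shiftSeq a t) k` for `k ≤ T`. -/
lemma conv_eq_sum_shift (a b : ℕ → ℕ) {T k : ℕ} (hk : k ≤ T) :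
    conv a b k = ∑ t ∈ range (T + 1), b t * shiftSeq a t k := by
  unfold conv
  rw [← Finset.sum_range_reflect (fun s => a s * b (k - s)) (k + 1)]
  have h1 : ∑ j ∈ range (k + 1), a (k + 1 - 1 - j) * b (k - (k + 1 - 1 - j)) =
      ∑ t ∈ range (k + 1), b t * shiftSeq a t k := by
    refine Finset.sum_congr rfl fun t ht => ?_
    rw [Finset.mem_range] at ht
    unfold shiftSeq
    rw [if_pos (by omega)]
    have e1 : k + 1 - 1 - t = k - t := by omega
    have e2 : k - (k - t) = t := by omega
    rw [e1, e2, mul_comm]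
  rw [h1]
  have hsub : range (k + 1) ⊆ range (T + 1) := by
    intro x hx
    rw [Finset.mem_range] at hx ⊢
    omega
  refine Finset.sum_subset hsub fun t ht ht' => ?_
  rw [Finset.mem_range] at ht ht'
  rw [shiftSeq_eq_zero_of_lt (by omega), mul_zero]

/-! ## The theorem -/

/-- **THE CUMULATIVE SKEW IS ADDITIVE UNDER CONVOLUTION**: `Skew a R₁ → Skew b R₂ → Skew (a ⋆ b) (R₁ + R₂)`. -/
theorem skew_conv {a b : ℕ → ℕ} {R₁ R₂ : ℕ} (ha : Skew a R₁) (hb : Skew b R₂) :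
    Skew (conv a b) (R₁ + R₂) := by
  classical
  -- strong induction on the mass of `b` below `R₁ + R₂`
  suffices H : ∀ N : ℕ, ∀ b : ℕ → ℕ, Skew b R₂ → ∑ t ∈ range (R₁ + R₂ + 1), b t = N →
      Skew (conv a b) (R₁ + R₂) from H _ b hb rfl
  intro N
  induction N using Nat.strong_induction_on with
  | _ N ih =>
    intro b hb hN
    by_cases hex : ∃ t, t ≤ R₁ + R₂ ∧ 0 < b t
    · -- `m` = the lowest support point below `R₁ + R₂`
      set m := Nat.find hex with hm
      have hmspec : m ≤ R₁ + R₂ ∧ 0 < b m := Nat.find_spec hex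
      have hmin : ∀ t, t < m → b t = 0 := by
        intro t ht
        have := Nat.find_min hex ht
        push Not at this
        exact Nat.le_zero.mp (this (by omega))
      by_cases h2m : 2 * m ≤ R₂
      · -- peel the lowest level on the symmetric window `[m, R₂ − m]`
        have hge : ∀ t, m ≤ t → t ≤ R₂ - m → b m ≤ b t := by
          intro t hmt htR
          rcases Nat.eq_or_lt_of_le hmt with rfl | hlt
          · exact le_rfl
          · exact hb m t hlt (by omega)
        set b' : ℕ → ℕ := fun t => b t - b m * indSeq m (R₂ - m) t with hb'
        have hdecomp : ∀ t, b t = b m * indSeq m (R₂ - m) t + b' t := by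
          intro t
          simp only [hb', indSeq]
          split_ifs with h
          · have := hge t h.1 h.2
            omega
          · omega
        have hskew' : Skew b' R₂ := by
          intro i j hij hR
          simp only [hb', indSeq]
          by_cases hi : m ≤ i ∧ i ≤ R₂ - m
          · have hj : m ≤ j ∧ j ≤ R₂ - m := ⟨by omega, by omega⟩
            rw [if_pos hi, if_pos hj]
            have := hb i j hij hR
            omega
          · rw [if_neg hi]
            by_cases him : i < m
            · rw [hmin i him]
              exact Nat.zero_le _
            · exfalso
              omega
        have hmass : ∑ t ∈ range (R₁ + R₂ + 1), b' t < N := by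
          have hsum : ∑ t ∈ range (R₁ + R₂ + 1), b t =
              ∑ t ∈ range (R₁ + R₂ + 1), (b m * indSeq m (R₂ - m) t + b' t) :=
            Finset.sum_congr rfl fun t _ => hdecomp t
          rw [Finset.sum_add_distrib] at hsum
          have hpos : 0 < ∑ t ∈ range (R₁ + R₂ + 1), b m * indSeq m (R₂ - m) t := by
            refine Finset.sum_pos' (fun t _ => Nat.zero_le _) ⟨m, Finset.mem_range.mpr (by omega), ?_⟩
            unfold indSeq
            rw [if_pos ⟨le_rfl, by omega⟩, mul_one]
            exact hmspec.2
          omega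
        have hconv : ∀ k, conv a b k = b m * conv a (indSeq m (R₂ - m)) k + conv a b' k := by
          intro k
          rw [← conv_add_smul]
          congr 1
          funext t
          exact hdecomp t
        have h1 := skew_smul (skew_conv_indSeq ha h2m) (b m)
        have h2 := ih _ hmass b' hskew' rfl
        exact skew_congr (skew_add h1 h2) fun k _ => (hconv k).symm
      · -- every support point `t` has `2t > R₂`: `a ⋆ b` is a sum of shifts with parameter `> R₁ + R₂`
        push Not at h2m
        have hsum : Skew (fun k => ∑ t ∈ range (R₁ + R₂ + 1), b t * shiftSeq a t k) (R₁ + R₂) := by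
          refine skew_sum _ _ fun t ht => ?_
          by_cases hbt : b t = 0
          · rw [hbt]
            simpa using skew_zero (R₁ + R₂)
          · have htm : m ≤ t := by
              by_contra hlt
              exact hbt (hmin t (by omega))
            exact skew_smul (skew_mono (skew_shift ha t) (by omega)) (b t)
        exact skew_congr hsum fun k hk => (conv_eq_sum_shift a b hk).symm
    · -- `b` vanishes below `R₁ + R₂`: so does `a ⋆ b`
      push Not at hex
      intro i j hij hR
      have hz : ∀ k, k ≤ R₁ + R₂ → conv a b k = 0 := by
        intro k hk
        unfold conv
        refine Finset.sum_eq_zero fun s hs => ?_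
        rw [Finset.mem_range] at hs
        rw [Nat.le_zero.mp (hex (k - s) (by omega)), mul_zero]
      rw [hz i (by omega), hz j (by omega)]

end SkewConv

end PercRepro
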